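import Summits.BirchSwinnertonDyer.Rank1Residual.X11a.NonSurjectiveLeaf
import Literature.NumberTheory.EllipticCurves.Rank1Residual.X9TrivialPartner
import HarnessLib

/-!
# Class X11a: `BSD(E,p)` at a multiplicative prime from a CONGRUENT PARTNER WITH TRIVIAL `p`-PRIMARY
# ARITHMETIC — route (3d), the X11a twin of X9's route U2 (cell `b2b-bsdres`, unit `b2b-bsdres-x11a`, gen 24)

HONEST FRAMING (run/shared/lean/b2b/bsd-rank1-residual/, verbatim in every file): the goal of the
cell is to DELETE the COMBINATION-SHAPED residual classes of the Birch–Swinnerton-Dyer formula for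
ALL analytic-rank `≤ 1` elliptic curves over `ℚ` — "full BSD formula for every rank `≤ 1` curve in
class `C`" assembled STRICTLY from published theorems — so that the rank-`≤ 1` remainder becomes
exactly the CONSTRUCTION-SHAPED classes, which are TYPED (missing-input `Prop`s), NOT attempted.
This is not "finishing BSD". Research route; NO CLAIM BEYOND STATED CLASSES. Theorems only: no
definition, no new named fact; every published input is an explicit NAMED-FACT hypothesis already in
the tree; the per-pair certificates are EXPLICIT binders; nothing is booked by this file and no
label changes (cell lead / referee).

WHAT. The END STATE of X11a (`X11a/NonSurjectiveLeaf.lean`, `target_of_endState_routes`; gen 23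
`…_routes_bc`) supplies input (3) — Mazur's main conjecture at a NON-surjective leaf pair
(`p ∈ {5,7}`, `p ∣ ord_p Δ_min`, images `5Ns`, `5S4`, `7Ns`) — per pair by (3a) a CM elliptic-curve
partner (Rubin 1991 + EPW Cor. 5.1.4 + certificates C1, C2), (3b) `p ∤ #Ш_an` with a full
`p`-descent certificate, or (3c) the typed conjecture itself. (3a) needs a CM member of `H(E[p])`
(Cartan field `ℚ(i)` only: 16 of the 28 `5Ns` curves, none of the `5S4` ones), (3b) needs an exact
`5`-descent (x11c's engine is GRH-conditional on `5S4`). THIS FILE adds route **(3d)**, which needs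
NO CM and NO descent on `E`: the X11a twin of the accepted X9 theorem
`X9.bsdp_of_trivialPartner` (route U2, `Literature/…/Rank1Residual/X9TrivialPartner.lean`), with
Greenberg–Vatsal's good-ordinary → good-ordinary transfer replaced by Emerton–Pollack–Weston's
good-ordinary → MULTIPLICATIVE one (`cor514_transfer_of_goodOrdinary`, x11a gen 8, PUB, the fact
already consumed by (3a)):

**Route (3d) (trivial partner).** Let `(E,p)`, `p ≥ 5`, be multiplicative at `p` with `E[p]`
irreducible, and let `A/ℚ` be a globally minimal curve with `A[p] ≅ E[p]` (`Γ_ℚ`-equivariantly: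
certificate C1, finite by Kraus–Oesterlé 1992 Prop. 4), GOOD ORDINARY and NON-ANOMALOUS at `p`
(`p ∤ #Ã(𝔽_p)`), with `p ∤ ∏_ℓ c_ℓ(A)`, `ord_p(L(A,1)/Ω_A) = 0` and `Sel_{p^∞}(A/ℚ) = 0`. Then
(`mazurMainConjecture_with_mu_zero_of_trivialArithmetic`, X9 gen 5: BCS 2025 Thm. 1.1.2 (a) for `A`
— torsion + principal characteristic ideal, NO image hypothesis — Greenberg's Thm. 4.1, integrality)
Mazur's main conjecture holds for `(A,p)` TRIVIALLY with `μ = λ = 0`, and EPW Cor. 5.1.4 + Thm. 5.1.3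
carry it along C1 to `(E,p)`: `MultiplicativeCharIdealMuZero W p` — Mazur's statement at the
multiplicative prime, INTEGRALLY, WITH `μ = 0`, for EVERY image type of `ρ̄_{E,p}` (surjective or
not). The cell's height-free rank-`0` glue then gives `BSD(E,p)` on X11a; x11c's typed input
`X11b.MultDivisibilityAt` follows for the rank-`1` twin class.

* `multCharIdealMuZero_of_trivialPartner` — the tool (any `E` multiplicative at `p ≥ 5`, `E[p]`
  irreducible; serves X11a and X11b).
* `mazurMainConjectureAt_of_trivialPartner`, `multDivisibilityAt_of_trivialPartner` — the leaf's
  typed input (3) and x11c's input, discharged at every pair with a trivial partner.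
* `bsdp_of_trivialPartner` — **`BSD(E,p)` at an X11a pair (`p ≥ 5`, either leaf) from PUBLISHED
  facts (BCS 1.1.2 (a), Greenberg 4.1, the period ratio, EPW 5.1.4, Stein–Wuthrich 6.1 ×2,
  Greenberg–Stevens, GZK, modularity) + C1 + the partner's four finite certificates.**
* `bsdp_of_trivialPartner_of_bsdp_partner` — the partner's Selmer certificate discharged from
  `BSDp A p` in analytic rank `0` (X9's `natCard_selmerGroupPInfty_eq_one_of_bsdp`): the
  CLASS-CLOSURE TRANSPORT STATEMENT for N7 — **`BSD(A,p) ⟹ BSD(E,p)`** along a `p`-congruence from a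
  rank-`0`, good-ordinary, non-anomalous partner with `p`-unit Tamagawa product and `p`-unit
  `L(A,1)/Ω_A` (the join the lane's `class-closure/N7/congruence-screen-links.tsv` asks for).
* `bsdp_of_trivialPartner_of_conductor_lt` — every certificate finite, every input published:
  partner of conductor `< 5000` (Miller 2011 / Creutz–Miller 2012, `hMiller`), C1 as the
  Kraus–Oesterlé congruence list (`hKO`).
* the END STATE with input (3) split FOUR ways ((3a) CM partner / (3b) descent / (3c) Mazur's MC /
  (3d) trivial partner) is the companion file `X11a/EndStateTrivialPartner.lean`.

Why (3d) is not vacuous on the non-surjective leaf: `E[p]` there is finite flat at `p` (peu ramifié,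
`p ∣ ord_p Δ_min`), so weight-two members of `H(E[p])` of level prime to `p` exist (Ribet); at
`p = 5` the twist family `X_E(5) ≅ ℙ¹` (Rubin–Silverberg) makes `5`-congruent partners abundant, and
the lane's congruence screen (cc-eng-3, kit j120563) lists small-conductor rank-`0` partners for
`5S4`/`5Ns` cells of record (e.g. `115320m1 ↔ 7688d1`, `51840bd1 ↔ 10368u1`, `317520cp1 ↔ 63504j1`
@5; to be certified at the Kraus–Oesterlé bound — HOME/b2b-bsdres-x11a/g24/). Which pairs carry a
trivial partner is a per-pair fact; nothing is closed by this file until C1 and the partner's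
certificates are lane-certified (referee R17.3 discipline); the class label is unchanged.

References: [EmertonPollackWeston2006] Cor. 5.1.4, Thm. 5.1.3 (arXiv:math/0404484 p. 30), Ex.
5.3.1–5.3.2; [BurungaleCastellaSkinner2025] Thm. 1.1.2 (a); [GreenbergLNM1716] Thm. 4.1;
[GreenbergVatsal2000] §3 Prop. (3.1), Rem. (3.4); [KrausOesterle1992] Prop. 4; [Miller2011LMS]
Thm. 1.2; [CreutzMiller2012] Thm. 1.1; [SteinWuthrich2013] Thm. 6.1; X9 route U2
(`X9TrivialPartner.lean`, HOME/b2b-bsdres-x9/X9-U2-G5.md); HOME/b2b-bsdres-x11a/REPORT-g24.md.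
-/

noncomputable section

open scoped Classical MatrixGroups ModularForm

open CongruenceSubgroup WeierstrassCurve Literature.NumberTheory.EllipticCurves
  Literature.NumberTheory.EllipticCurves.ModularForms
  Literature.NumberTheory.EllipticCurves.Rank1Residual
  Literature.NumberTheory.EllipticCurves.Rank1Residual.Typed
  Literature.NumberTheory.EllipticCurves.Wuthrich2014
  Literature.NumberTheory.EllipticCurves.SteinWuthrich2013
  Literature.NumberTheory.EllipticCurves.GreenbergVatsal2000
  Literature.NumberTheory.EllipticCurves.EmertonPollackWeston2006
  Literature.NumberTheory.EllipticCurves.BalakrishnanEtAl2019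
  Summit.BirchSwinnertonDyer.Rank1Residual.RankZeroHeightFree

set_option autoImplicit false

namespace Summit.BirchSwinnertonDyer.Rank1Residual.X11a

/-! ### The tool: Mazur's statement with `μ = 0` at a multiplicative prime from a trivial partner -/

section Tool

variable (W A : WeierstrassCurve ℚ) [W.IsElliptic] [W.IsGloballyMinimal] [A.IsElliptic]
  [A.IsGloballyMinimal] (p : ℕ) [Fact p.Prime]

/-- **Mazur's main conjecture at a MULTIPLICATIVE prime, integrally and with `μ = 0`, from a
congruent partner with trivial `p`-primary arithmetic.** Let `E = W/ℚ` be globally minimal with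
multiplicative reduction at `p ≥ 5` and `E[p]` irreducible, and let `A/ℚ` be globally minimal, GOOD
ORDINARY at `p`, with the four finite certificates of X9's route U2: non-anomalous (`hna`:
`p ∤ #Ã(𝔽_p)`), `p ∤ ∏ c_ℓ(A)` (`htam`), `L(A,1)/Ω_A` a non-zero rational of `p`-adic valuation `0`
(`hL`), `#Sel_{p^∞}(A/ℚ) = 1` (`hSel`); GIVEN C1 (`hC1`: a `Γ_ℚ`-equivariant additive isomorphism
`A[p] ≃ E[p]`). Then `MultiplicativeCharIdealMuZero W p`. Inputs: BCS 2025 Thm. 1.1.2 (a) (`hBCS`,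
for `A` only: torsion + principal characteristic ideal, no image hypothesis), Greenberg LNM 1716
Thm. 4.1 (`hGr`), the period ratio (`hΩ`) — through X9's
`mazurMainConjecture_with_mu_zero_of_trivialArithmetic`, whose conclusion IS
`GoodOrdinaryCharIdealMuZero A p` — and Emerton–Pollack–Weston Cor. 5.1.4 + Thm. 5.1.3 good
ordinary → multiplicative (`hEPW`); irreducibility of `A[p]` is that of `E[p]` transported along C1.
Serves X11a (`r = 0`) and X11b (`r = 1`) alike, surjective image or not.
[cite: EmertonPollackWeston2006, Cor. 5.1.4 and Thm. 5.1.3 (arXiv:math/0404484 p. 30); Ex. 5.3.1–5.3.2 (pp. 32–33)]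
[cite: BurungaleCastellaSkinner2025, Thm. 1.1.2 (a)] [cite: GreenbergLNM1716, Thm. 4.1 (p. 102)] -/
theorem multCharIdealMuZero_of_trivialPartner
    (hBCS : burungale_castella_skinner_charIdeal_eq_padicLFunction)
    (hGr : greenberg_charValue_rankZero) (hΩ : realPeriodRat_eq_unit_mul_plusPeriod)
    (hEPW : cor514_transfer_of_goodOrdinary)
    (h5 : 5 ≤ p) (hmult : W.HasMultiplicativeReductionAtPrime p)
    (hirr : W.HasIrreducibleModPGaloisRep p)
    (hgoodA : A.HasGoodReductionAtPrime p) (hordA : ¬ (p : ℤ) ∣ A.frobeniusTrace p)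
    (hna : ¬ p ∣ A.reductionPointCount p) (htam : ¬ p ∣ A.tamagawaProduct)
    (hL : ∃ q : ℚ, q ≠ 0 ∧ A.entireLFunction 1 / (A.realPeriodRat : ℂ) = (q : ℂ) ∧ padicValRat p q = 0)
    (hSel : Nat.card (A.selmerGroupPInfty p) = 1)
    (hC1 : ∃ e : geomTorsion A (p : ℤ) ≃+ geomTorsion W (p : ℤ),
      ∀ (σ : Field.absoluteGaloisGroup ℚ) (P : geomTorsion A (p : ℤ)), e (σ • P) = σ • e P) :
    MultiplicativeCharIdealMuZero W p := by
  obtain ⟨e, he⟩ := hC1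
  have hirrA : A.HasIrreducibleModPGaloisRep p :=
    hasIrreducibleModPGaloisRep_of_torsionIso_symm e he hirr
  exact hEPW A W p h5 hgoodA hordA hmult ⟨e, he⟩ hirrA
    (mazurMainConjecture_with_mu_zero_of_trivialArithmetic hBCS hGr hΩ A p h5 hgoodA hordA hirrA
      hna htam hL hSel)

/-- **Route (3d) discharges the leaf's typed input**: a trivial partner with C1 gives
`X2.MazurMainConjectureAt W p` at a multiplicative `p ≥ 5` with `E[p]` irreducible (drop `μ = 0`,
`mazurMainConjectureAt_of_multCharIdealMuZero`).
[cite: EmertonPollackWeston2006, Cor. 5.1.4 (arXiv:math/0404484 p. 30)] -/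
theorem mazurMainConjectureAt_of_trivialPartner
    (hBCS : burungale_castella_skinner_charIdeal_eq_padicLFunction)
    (hGr : greenberg_charValue_rankZero) (hΩ : realPeriodRat_eq_unit_mul_plusPeriod)
    (hEPW : cor514_transfer_of_goodOrdinary)
    (h5 : 5 ≤ p) (hmult : W.HasMultiplicativeReductionAtPrime p)
    (hirr : W.HasIrreducibleModPGaloisRep p)
    (hgoodA : A.HasGoodReductionAtPrime p) (hordA : ¬ (p : ℤ) ∣ A.frobeniusTrace p)
    (hna : ¬ p ∣ A.reductionPointCount p) (htam : ¬ p ∣ A.tamagawaProduct)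
    (hL : ∃ q : ℚ, q ≠ 0 ∧ A.entireLFunction 1 / (A.realPeriodRat : ℂ) = (q : ℂ) ∧ padicValRat p q = 0)
    (hSel : Nat.card (A.selmerGroupPInfty p) = 1)
    (hC1 : ∃ e : geomTorsion A (p : ℤ) ≃+ geomTorsion W (p : ℤ),
      ∀ (σ : Field.absoluteGaloisGroup ℚ) (P : geomTorsion A (p : ℤ)), e (σ • P) = σ • e P) :
    X2.MazurMainConjectureAt W p :=
  mazurMainConjectureAt_of_multCharIdealMuZero
    (multCharIdealMuZero_of_trivialPartner W A p hBCS hGr hΩ hEPW h5 hmult hirr hgoodA hordA hna htam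
      hL hSel hC1)

/-- **Route (3d) for the rank-one twin class X11b**: a trivial partner with C1 gives x11c's typed
divisibility input `X11b.MultDivisibilityAt W p` (consumers:
`X11b.bsdp_of_multDivisibilityAt_{split,nonsplit}_of_certificate`).
[cite: EmertonPollackWeston2006, Cor. 5.1.4 (arXiv:math/0404484 p. 30)] -/
theorem multDivisibilityAt_of_trivialPartner
    (hBCS : burungale_castella_skinner_charIdeal_eq_padicLFunction)
    (hGr : greenberg_charValue_rankZero) (hΩ : realPeriodRat_eq_unit_mul_plusPeriod)
    (hEPW : cor514_transfer_of_goodOrdinary)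
    (h5 : 5 ≤ p) (hmult : W.HasMultiplicativeReductionAtPrime p)
    (hirr : W.HasIrreducibleModPGaloisRep p)
    (hgoodA : A.HasGoodReductionAtPrime p) (hordA : ¬ (p : ℤ) ∣ A.frobeniusTrace p)
    (hna : ¬ p ∣ A.reductionPointCount p) (htam : ¬ p ∣ A.tamagawaProduct)
    (hL : ∃ q : ℚ, q ≠ 0 ∧ A.entireLFunction 1 / (A.realPeriodRat : ℂ) = (q : ℂ) ∧ padicValRat p q = 0)
    (hSel : Nat.card (A.selmerGroupPInfty p) = 1)
    (hC1 : ∃ e : geomTorsion A (p : ℤ) ≃+ geomTorsion W (p : ℤ),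
      ∀ (σ : Field.absoluteGaloisGroup ℚ) (P : geomTorsion A (p : ℤ)), e (σ • P) = σ • e P) :
    X11b.MultDivisibilityAt W p :=
  multDivisibilityAt_of_multCharIdealMuZero W p
    (multCharIdealMuZero_of_trivialPartner W A p hBCS hGr hΩ hEPW h5 hmult hirr hgoodA hordA hna htam
      hL hSel hC1)

end Tool

/-! ### `BSD(E,p)` on X11a from a trivial partner -/

section Main

variable (W A : WeierstrassCurve ℚ) [W.IsElliptic] [W.IsGloballyMinimal] [A.IsElliptic]
  [A.IsGloballyMinimal] (p : ℕ) [Fact p.Prime]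

/-- **Kernel theorem of route (3d): `BSD(E,p)` at an X11a pair (`p ≥ 5`, surjective image or not)
from a congruent partner with trivial `p`-primary arithmetic and C1.** PUBLISHED named facts:
modularity once (`hNf`), BCS 2025 Thm. 1.1.2 (a) (`hBCS`, for `A`), Greenberg LNM 1716 Thm. 4.1
(`hGr`), the period ratio (`hΩ`), EPW Cor. 5.1.4 good ordinary → multiplicative (`hEPW`),
Stein–Wuthrich 2013 Thm. 6.1 split / non-split (`hJs`, `hJn`), GZK (`hGZK`), Greenberg–Stevens
(`hGS`); the class `ClassX11a W p`, `5 ≤ p`; the partner `A` (good ordinary at `p`) with the finite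
certificates `hna`, `htam`, `hL`, `hSel`; C1 (`hC1`). Glue:
`mazurMainConjectureAt_of_trivialPartner` + `bsdp_of_mazurMainConjectureAt_heightFree`. No pair is
closed by this theorem until its certificates are certified for it.
[cite: EmertonPollackWeston2006, Cor. 5.1.4 and Thm. 5.1.3 (arXiv:math/0404484 p. 30)]
[cite: BurungaleCastellaSkinner2025, Thm. 1.1.2 (a)] [cite: SteinWuthrich2013, Thm. 6.1 (p. 20)] -/
theorem bsdp_of_trivialPartner (hNf : exists_isNewformOf)
    (hBCS : burungale_castella_skinner_charIdeal_eq_padicLFunction)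
    (hGr : greenberg_charValue_rankZero) (hΩ : realPeriodRat_eq_unit_mul_plusPeriod)
    (hEPW : cor514_transfer_of_goodOrdinary)
    (hJs : thm61_splitMultiplicative) (hJn : thm61_nonsplitMultiplicative)
    (hGZK : rank_eq_analyticRank_of_analyticRank_le_one)
    (hGS : greenberg_stevens (W := W) (p := p))
    (hX : ClassX11a W p) (h5 : 5 ≤ p)
    (hgoodA : A.HasGoodReductionAtPrime p) (hordA : ¬ (p : ℤ) ∣ A.frobeniusTrace p)
    (hna : ¬ p ∣ A.reductionPointCount p) (htam : ¬ p ∣ A.tamagawaProduct)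
    (hL : ∃ q : ℚ, q ≠ 0 ∧ A.entireLFunction 1 / (A.realPeriodRat : ℂ) = (q : ℂ) ∧ padicValRat p q = 0)
    (hSel : Nat.card (A.selmerGroupPInfty p) = 1)
    (hC1 : ∃ e : geomTorsion A (p : ℤ) ≃+ geomTorsion W (p : ℤ),
      ∀ (σ : Field.absoluteGaloisGroup ℚ) (P : geomTorsion A (p : ℤ)), e (σ • P) = σ • e P) :
    BSDp W p :=
  bsdp_of_mazurMainConjectureAt_heightFree hJs hJn hGZK (hasEntireLFunction_rat_of_exists_isNewformOf hNf)
    (nonempty_modularParametrizationData_of_exists_isNewformOf hNf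
      IsNewformOf.exists_maninConstant_ne_zero_holds) hGS hX
    (mazurMainConjectureAt_of_trivialPartner W A p hBCS hGr hΩ hEPW h5 hX.mult hX.irr hgoodA hordA hna
      htam hL hSel hC1)

/-- **The class-closure TRANSPORT statement for N7: `BSD(A,p) ⟹ BSD(E,p)` along a `p`-congruence.**
As `bsdp_of_trivialPartner`, with the partner's Selmer certificate DISCHARGED from `BSDp A p` in
analytic rank `0` (`natCard_selmerGroupPInfty_eq_one_of_bsdp`: `r_an(A) = 0`, `A[p]` irreducible —
transported from `E[p]` along C1 —, `p ∤ ∏ c_ℓ(A)`, `ord_p(L(A,1)/Ω_A) = 0` and `BSD(A,p)` give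
`Ш(A)[p^∞] = 0`). So an X11a pair closes as soon as ONE rank-`0`, good-ordinary, non-anomalous
`p`-congruent partner with `p`-unit Tamagawa product and `p`-unit `L(A,1)/Ω_A` is closed at `p` —
by ANY route. [cite: EmertonPollackWeston2006, Cor. 5.1.4 (arXiv:math/0404484 p. 30)]
[cite: GreenbergLNM1716, Thm. 4.1 (p. 102) and §4 p. 103] -/
theorem bsdp_of_trivialPartner_of_bsdp_partner (hNf : exists_isNewformOf)
    (hBCS : burungale_castella_skinner_charIdeal_eq_padicLFunction)
    (hGr : greenberg_charValue_rankZero) (hΩ : realPeriodRat_eq_unit_mul_plusPeriod)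
    (hEPW : cor514_transfer_of_goodOrdinary)
    (hJs : thm61_splitMultiplicative) (hJn : thm61_nonsplitMultiplicative)
    (hGZK : rank_eq_analyticRank_of_analyticRank_le_one)
    (hGS : greenberg_stevens (W := W) (p := p))
    (hX : ClassX11a W p) (h5 : 5 ≤ p)
    (hgoodA : A.HasGoodReductionAtPrime p) (hordA : ¬ (p : ℤ) ∣ A.frobeniusTrace p)
    (hna : ¬ p ∣ A.reductionPointCount p) (htam : ¬ p ∣ A.tamagawaProduct)
    (hL : ∃ q : ℚ, q ≠ 0 ∧ A.entireLFunction 1 / (A.realPeriodRat : ℂ) = (q : ℂ) ∧ padicValRat p q = 0)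
    (hrA : A.analyticRank = 0) (hbsdA : BSDp A p)
    (hC1 : ∃ e : geomTorsion A (p : ℤ) ≃+ geomTorsion W (p : ℤ),
      ∀ (σ : Field.absoluteGaloisGroup ℚ) (P : geomTorsion A (p : ℤ)), e (σ • P) = σ • e P) :
    BSDp W p := by
  obtain ⟨e, he⟩ := hC1
  have hirrA : A.HasIrreducibleModPGaloisRep p :=
    hasIrreducibleModPGaloisRep_of_torsionIso_symm e he hX.irr
  exact bsdp_of_trivialPartner W A p hNf hBCS hGr hΩ hEPW hJs hJn hGZK hGS hX h5 hgoodA hordA hna htam hL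
    (natCard_selmerGroupPInfty_eq_one_of_bsdp hGZK A p hirrA hrA htam hL hbsdA) ⟨e, he⟩

/-- **Route (3d) with C1 as the Kraus–Oesterlé congruence list** (canonical cell shape; the
`Γ_ℚ`-equivariant `A[p] ≃ E[p]` DERIVED from the finite trace congruences below the Kraus–Oesterlé
bound by the named fact `hKO`, irreducibility of `E[p]` from the class).
[cite: KrausOesterle1992, Prop. 4] [cite: EmertonPollackWeston2006, Cor. 5.1.4 (arXiv:math/0404484 p. 30)] -/
theorem bsdp_of_trivialPartner_of_congruences (hNf : exists_isNewformOf)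
    (hKO : KrausOesterle1992.prop4_torsionIso_of_congruences)
    (hBCS : burungale_castella_skinner_charIdeal_eq_padicLFunction)
    (hGr : greenberg_charValue_rankZero) (hΩ : realPeriodRat_eq_unit_mul_plusPeriod)
    (hEPW : cor514_transfer_of_goodOrdinary)
    (hJs : thm61_splitMultiplicative) (hJn : thm61_nonsplitMultiplicative)
    (hGZK : rank_eq_analyticRank_of_analyticRank_le_one)
    (hGS : greenberg_stevens (W := W) (p := p))
    (hX : ClassX11a W p) (h5 : 5 ≤ p)
    (hgoodA : A.HasGoodReductionAtPrime p) (hordA : ¬ (p : ℤ) ∣ A.frobeniusTrace p)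
    (hna : ¬ p ∣ A.reductionPointCount p) (htam : ¬ p ∣ A.tamagawaProduct)
    (hL : ∃ q : ℚ, q ≠ 0 ∧ A.entireLFunction 1 / (A.realPeriodRat : ℂ) = (q : ℂ) ∧ padicValRat p q = 0)
    (hSel : Nat.card (A.selmerGroupPInfty p) = 1)
    (hcong : ∀ (ℓ : ℕ) [Fact ℓ.Prime],
      6 * ℓ < KrausOesterle1992.gammaZeroIndex (KrausOesterle1992.modulus W A) →
      (padicValNat ℓ (W.conductorNorm ℤ * A.conductorNorm ℤ) = 0 →
          (p : ℤ) ∣ W.frobeniusTrace ℓ - A.frobeniusTrace ℓ) ∧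
        (padicValNat ℓ (W.conductorNorm ℤ * A.conductorNorm ℤ) = 1 →
          (p : ℤ) ∣ W.frobeniusTrace ℓ * A.frobeniusTrace ℓ - (ℓ + 1))) :
    BSDp W p :=
  bsdp_of_trivialPartner W A p hNf hBCS hGr hΩ hEPW hJs hJn hGZK hGS hX h5 hgoodA hordA hna htam hL hSel
    (KrausOesterle1992.torsionIso_of_congruences hKO W A p hX.irr hcong)

/-- **Route (3d) with a partner of conductor `< 5000`: every certificate finite, every input
published.** The partner's Selmer certificate is discharged by Miller 2011 / Creutz–Miller 2012
(`hMiller`, `bsdp_of_irreducible_of_conductor_lt`) from `r_an(A) = 0`, `N_A < 5000`,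
`p ∤ ∏ c_ℓ(A)`, `ord_p(L(A,1)/Ω_A) = 0` (`natCard_selmerGroupPInfty_eq_one_of_conductor_lt`); C1 is
the Kraus–Oesterlé list. Remaining binders: PUBLISHED facts `hNf`, `hKO`, `hMiller`, `hBCS`, `hGr`,
`hΩ`, `hEPW`, `hJs`, `hJn`, `hGZK`, `hGS`; FINITE certificates `hrA`, `hNA`, `hgoodA`, `hordA`,
`hna`, `htam`, `hL`, `hcong`. [cite: Miller2011LMS, Thm. 1.2] [cite: CreutzMiller2012, Thm. 1.1]
[cite: KrausOesterle1992, Prop. 4] [cite: EmertonPollackWeston2006, Cor. 5.1.4 (arXiv:math/0404484 p. 30)] -/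
theorem bsdp_of_trivialPartner_of_conductor_lt (hNf : exists_isNewformOf)
    (hKO : KrausOesterle1992.prop4_torsionIso_of_congruences)
    (hMiller : bsdp_of_irreducible_of_conductor_lt)
    (hBCS : burungale_castella_skinner_charIdeal_eq_padicLFunction)
    (hGr : greenberg_charValue_rankZero) (hΩ : realPeriodRat_eq_unit_mul_plusPeriod)
    (hEPW : cor514_transfer_of_goodOrdinary)
    (hJs : thm61_splitMultiplicative) (hJn : thm61_nonsplitMultiplicative)
    (hGZK : rank_eq_analyticRank_of_analyticRank_le_one)
    (hGS : greenberg_stevens (W := W) (p := p))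
    (hX : ClassX11a W p) (h5 : 5 ≤ p)
    (hrA : A.analyticRank = 0) (hNA : A.conductorNorm ℤ < 5000)
    (hgoodA : A.HasGoodReductionAtPrime p) (hordA : ¬ (p : ℤ) ∣ A.frobeniusTrace p)
    (hna : ¬ p ∣ A.reductionPointCount p) (htam : ¬ p ∣ A.tamagawaProduct)
    (hL : ∃ q : ℚ, q ≠ 0 ∧ A.entireLFunction 1 / (A.realPeriodRat : ℂ) = (q : ℂ) ∧ padicValRat p q = 0)
    (hcong : ∀ (ℓ : ℕ) [Fact ℓ.Prime],
      6 * ℓ < KrausOesterle1992.gammaZeroIndex (KrausOesterle1992.modulus W A) →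
      (padicValNat ℓ (W.conductorNorm ℤ * A.conductorNorm ℤ) = 0 →
          (p : ℤ) ∣ W.frobeniusTrace ℓ - A.frobeniusTrace ℓ) ∧
        (padicValNat ℓ (W.conductorNorm ℤ * A.conductorNorm ℤ) = 1 →
          (p : ℤ) ∣ W.frobeniusTrace ℓ * A.frobeniusTrace ℓ - (ℓ + 1))) :
    BSDp W p := by
  have hC1 := KrausOesterle1992.torsionIso_of_congruences hKO W A p hX.irr hcong
  obtain ⟨e, he⟩ := hC1
  have hirrA : A.HasIrreducibleModPGaloisRep p :=
    hasIrreducibleModPGaloisRep_of_torsionIso_symm e he hX.irr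
  exact bsdp_of_trivialPartner W A p hNf hBCS hGr hΩ hEPW hJs hJn hGZK hGS hX h5 hgoodA hordA hna htam hL
    (natCard_selmerGroupPInfty_eq_one_of_conductor_lt hMiller hGZK A p hirrA hrA hNA htam hL) ⟨e, he⟩

end Main

end Summit.BirchSwinnertonDyer.Rank1Residual.X11a

end
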